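import Literature.AnabelianGeometry.SemiGraphs.PSCSmoothProperGenuineOrigin
import HarnessLib

/-!
# [CombGC] Prop. 1.5 (ii), Thm. 1.6 (ii)(iii), Rmk. 1.4.3: BINDER-FREE instance forms at the smooth-proper one-vertex origin (FACT-LIST rows F-0442, F-0444, F-0461, F-0466) — proof-only

Mochizuki, *A combinatorial version of the Grothendieck conjecture* [CombGC], Tohoku Math. J. **59**
(2007), §1: Proposition 1.5 (ii) p. 13 ("`α` is graphic if and only if it is group-theoretically
edge-like and group-theoretically verticial …"), Theorem 1.6 (ii) p. 13 ("`α` is graphic if and only if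
it is graphically filtration-preserving"), Theorem 1.6 (iii) p. 13 ("Assume that `G`, `H` are sturdy. Then
`β` is verticially filtration-preserving if and only if it is group-theoretically verticial"), Remark 1.4.3
p. 12 (auxiliary coverings). [cite: MochizukiCombGC2007, §1 pp.12-13]

PROOF-ONLY file (abc-iut cell, F lane, KEY INST59Ic, seat abc-iut-f-164 gen 6; no `def`, no `instance`,
nothing re-typed).  The four rows are typed by abc-iut-L3-t4 as the datum-level predicate
`PSCDatum.GraphicIffEdgeLikeVerticial G H α` (F-0442) and the origin schemata
`GraphicIffFiltrationPreservingHolds Ω` (F-0444), `UnrVerticialIffHolds Ω` (F-0461) (`PSCGraphicity.lean`),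
`AuxiliaryCoveringsExistHolds Ω` (F-0466) (`PSCRamification.lean`).  Their UNIVERSAL CLOSURES ARE REFUTED
in the tree (`not_forall_graphicIffEdgeLikeVerticial`, `not_forall_graphicIffFiltrationPreservingHolds`,
`not_forall_unrVerticialIffHolds`, `not_forall_auxiliaryCoveringsExistHolds`): they are SCHEMATA whose
content is their instance forms.  The tree's closers for them all carried hypotheses (the smooth-proper
shape hypotheses `hΩ` of `…_of_smoothProper`, `PSCSmoothProperOrigin.lean` / `PSCSmoothProperShape.lean`),
and the joint-satisfiability theorem `exists_smoothProperOrigin_holds` (`PSCUnrVerticialOneVertex.lean`)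
carries the three origin rows only as deep conjuncts.  This file records the CLOSED instance forms
(0 binders / 0 hypotheses, conclusion head = the row's declaration):

* `Ω_sp` := the smooth-proper one-vertex origin "no nodes, no cusps, every `Π_v = Π`, one vertex"
  (verbatim the origin of `exists_smoothProperOrigin_holds`), written as a closed term.  It is INHABITED
  by GENUINE data: `smoothProperOrigin_isOfPSCType_genusTwo` (the datum of a smooth proper genus-2 curve
  in characteristic 0: carrier `Ŝ₂` = profinite completion of the closed surface group `S_2`, certified
  pro-`Σ` completion for `Σ` = all primes, one vertex of genus 2, sturdy) and, for every prime `ℓ`,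
  `smoothProperOrigin_isOfPSCType_proL_genusTwo` (its pro-`ℓ` version, `Σ = {ℓ}`, sturdy — so that the
  sturdiness / `Σ = {l}` guards of Thm. 1.6 (iii) and Rmk. 1.4.3 are met by members of `Ω_sp`);
* `graphicIffFiltrationPreservingHolds_smoothProperOrigin` (F-0444), `unrVerticialIffHolds_smoothProperOrigin`
  (F-0461), `auxiliaryCoveringsExistHolds_smoothProperOrigin` (F-0466): the three schemata HOLD at `Ω_sp`;
* `graphicIffEdgeLikeVerticial_genusTwoProper` (F-0442): Prop. 1.5 (ii) HOLDS at the genuine datum `Ŝ₂`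
  (both `G` and `H`) for EVERY `α : Ŝ₂ ≃ₜ* Ŝ₂`; `…_refl` is the fully closed case `α = id`;
  `exists_genuine_graphicIffEdgeLikeVerticial` the same with the datum's genuine provenance displayed.

HONEST LABEL: «INSTANCE-PROVED at the smooth-proper one-vertex origin (the degenerate-graph end of
[CombGC] §1: one vertex, no edges); ∀-closure REFUTED (schema) unchanged» — NOT "Prop. 1.5 / Thm. 1.6 /
Rmk. 1.4.3 proved": nothing is asserted about multi-vertex data or about all pointed stable curves.
Row F-0466 is moreover REFUTED at the genuine smooth-curve origins with cusps and at the two-component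
origins (`not_auxiliaryCoveringsExistHolds_of_smoothCurveGenuine`, `…_of_twoComponentOrigin`,
abc-iut-w5-d174); it holds here because the cuspidal and nodal clauses are vacuous and `G'' := G` serves
the verticial clause.  An instance-form theorem about OUR typed statement ≠ a theorem about [CombGC] in
print; typed ≠ proved; nothing here takes a side on [IUTchIII] Cor. 3.12.
-/

noncomputable section

namespace Literature.AnabelianGeometry.SemiGraphs

namespace PSCDatum

open scoped Pointwise
open Literature.Topology.FourManifolds (SurfaceGroup)
open SemiGraphOfAnabelioids (IsProSigmaCompletion)
open Literature.IUT.HodgeTheaters (profiniteCompletion toCompletion)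

/-! ### The smooth-proper one-vertex origin `Ω_sp` is inhabited by genuine data -/

/-- **`Ω_sp` contains the genuine datum of a smooth proper genus-2 curve.**  The origin
`Ω_sp` ("no nodes, no cusps, every `Π_v = Π`, exactly one vertex" — the origin of
`exists_smoothProperOrigin_holds`) declares "of PSC-type" the datum over `Ŝ₂` (profinite completion of the
closed surface group `S_2`; `toCompletion` is a certified pro-`Σ` completion for `Σ` = all primes) with one
vertex of genus 2, `Π_v = Π`, no nodes, no cusps; this datum is sturdy.
[cite: MochizukiCombGC2007, Def 1.1(i) p.6] -/
theorem smoothProperOrigin_isOfPSCType_genusTwo :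
    ∃ G : PSCDatum (profiniteCompletion (SurfaceGroup 2)),
      (⟨fun H => IsEmpty H.graph.N ∧ IsEmpty H.graph.C ∧ (∀ v, H.vertGp v = ⊤) ∧
          ∃ v₀ : H.graph.V, ∀ w, w = v₀⟩ : PSCOrigin.{0}).IsOfPSCType G ∧
      IsProSigmaCompletion G.Sigma (toCompletion (SurfaceGroup 2)) ∧ G.Sigma = {p | p.Prime} ∧
      G.graph.i = 1 ∧ G.graph.n = 0 ∧ G.graph.r = 0 ∧ (∀ v, G.vertGp v = ⊤ ∧ G.genus v = 2) ∧
      G.IsSturdy := by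
  let G : PSCDatum (profiniteCompletion (SurfaceGroup 2)) :=
    { Sigma := {p | p.Prime}
      sigma_prime := fun _ hp => hp
      sigma_nonempty := ⟨2, Nat.prime_two⟩
      graph := { V := Unit, N := Empty, C := Empty, nodeEnds := Empty.elim, cuspEnd := Empty.elim }
      vertGp := fun _ => ⊤
      nodeGp := Empty.elim
      cuspGp := Empty.elim
      genus := fun _ => 2
      isClosed_vertGp := fun _ => by rw [Subgroup.coe_top]; exact isClosed_univ
      isClosed_nodeGp := fun e => e.elim
      isClosed_cuspGp := fun c => c.elim
      nodeGp_le := fun e => e.elim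
      cuspGp_le := fun c => c.elim
      proSigma := ⟨fun _ _ _ hp _ => hp⟩ }
  exact ⟨G, ⟨inferInstanceAs (IsEmpty Empty), inferInstanceAs (IsEmpty Empty), fun _ => rfl, (),
      fun _ => rfl⟩, IsProSigmaCompletion.isProSigmaCompletion_toCompletion (SurfaceGroup 2), rfl, rfl,
    rfl, rfl, fun _ => ⟨rfl, rfl⟩, fun _ => le_rfl⟩

/-- **`Ω_sp` contains, for every prime `ℓ`, the genuine pro-`ℓ` datum of a smooth proper genus-2
curve**: a profinite `Π` with a certified pro-`ℓ` completion `ι : S_2 → Π`, `Σ = {ℓ}`, one vertex of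
genus 2 with `Π_v = Π`, no nodes, no cusps; sturdy.  (So the guards "`G`, `H` sturdy" of Thm. 1.6 (iii)
and "`Σ = {l}`, `G` sturdy" of Rmk. 1.4.3 are met inside `Ω_sp`.) [cite: MochizukiCombGC2007, Def 1.1(i) p.6] -/
theorem smoothProperOrigin_isOfPSCType_proL_genusTwo (ℓ : ℕ) (hℓ : ℓ.Prime) :
    ∃ (Q : ProfiniteGrp.{0}) (ι : SurfaceGroup 2 →* Q) (G : PSCDatum Q),
      (⟨fun H => IsEmpty H.graph.N ∧ IsEmpty H.graph.C ∧ (∀ v, H.vertGp v = ⊤) ∧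
          ∃ v₀ : H.graph.V, ∀ w, w = v₀⟩ : PSCOrigin.{0}).IsOfPSCType G ∧
      IsProSigmaCompletion {ℓ} ι ∧ G.Sigma = {ℓ} ∧ G.graph.i = 1 ∧ G.graph.n = 0 ∧ G.graph.r = 0 ∧
      (∀ v, G.vertGp v = ⊤ ∧ G.genus v = 2) ∧ G.IsSturdy := by
  obtain ⟨Q, ι, hι⟩ := IsProSigmaCompletion.exists_isProSigmaCompletion (SurfaceGroup 2) ({ℓ} : Set ℕ)
  let G : PSCDatum Q :=
    { Sigma := {ℓ}
      sigma_prime := fun p hp => by rw [Set.mem_singleton_iff.mp hp]; exact hℓ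
      sigma_nonempty := ⟨ℓ, Set.mem_singleton ℓ⟩
      graph := { V := Unit, N := Empty, C := Empty, nodeEnds := Empty.elim, cuspEnd := Empty.elim }
      vertGp := fun _ => ⊤
      nodeGp := Empty.elim
      cuspGp := Empty.elim
      genus := fun _ => 2
      isClosed_vertGp := fun _ => by rw [Subgroup.coe_top]; exact isClosed_univ
      isClosed_nodeGp := fun e => e.elim
      isClosed_cuspGp := fun c => c.elim
      nodeGp_le := fun e => e.elim
      cuspGp_le := fun c => c.elim
      proSigma := ⟨fun U _ p hp hdvd => by
        have h := hι.index_open (U : Subgroup Q) inferInstance U.isOpen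
        rw [← Subgroup.index_eq_card] at hdvd
        exact h.2 p hp hdvd⟩ }
  exact ⟨Q, ι, G, ⟨inferInstanceAs (IsEmpty Empty), inferInstanceAs (IsEmpty Empty), fun _ => rfl, (),
      fun _ => rfl⟩, hι, rfl, rfl, rfl, rfl, fun _ => ⟨rfl, rfl⟩, fun _ => le_rfl⟩

/-! ### F-0444, F-0461, F-0466: the origin schemata hold at `Ω_sp` (closed instance forms) -/

/-- **F-0444 / Thm. 1.6 (ii) INSTANCE-PROVED at the smooth-proper one-vertex origin `Ω_sp`** (closed,
binder-free; by abc-iut-L3-t4's `graphicIffFiltrationPreservingHolds_of_smoothProper`: at that shape every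
`α` is graphic and graphically filtration-preserving).  The universal closure over `Ω` is refuted
(`not_forall_graphicIffFiltrationPreservingHolds`); this is an instance of the typed schema, not Thm. 1.6 (ii)
for all pointed stable curves. [cite: MochizukiCombGC2007, Thm 1.6(ii) p.13] -/
theorem graphicIffFiltrationPreservingHolds_smoothProperOrigin :
    Literature.AnabelianGeometry.SemiGraphs.PSCDatum.GraphicIffFiltrationPreservingHolds
      (⟨fun H => IsEmpty H.graph.N ∧ IsEmpty H.graph.C ∧ (∀ v, H.vertGp v = ⊤) ∧
          ∃ v₀ : H.graph.V, ∀ w, w = v₀⟩ : PSCOrigin.{0}) :=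
  graphicIffFiltrationPreservingHolds_of_smoothProper _ fun _ _ _ _ h => h

/-- **F-0461 / Thm. 1.6 (iii) INSTANCE-PROVED at the smooth-proper one-vertex origin `Ω_sp`** (closed,
binder-free; by `unrVerticialIffHolds_of_smoothProper`: with `Π_v = Π` the unramified verticial subgroups
are exactly `Π^unr`, so every `β` is both verticially filtration-preserving and group-theoretically
verticial; the sturdiness guards are met by the genus-2 members of `Ω_sp`).  Universal closure refuted
(`not_forall_unrVerticialIffHolds`); instance of the typed schema only. [cite: MochizukiCombGC2007, Thm 1.6(iii) p.13] -/
theorem unrVerticialIffHolds_smoothProperOrigin :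
    Literature.AnabelianGeometry.SemiGraphs.PSCDatum.UnrVerticialIffHolds
      (⟨fun H => IsEmpty H.graph.N ∧ IsEmpty H.graph.C ∧ (∀ v, H.vertGp v = ⊤) ∧
          ∃ v₀ : H.graph.V, ∀ w, w = v₀⟩ : PSCOrigin.{0}) :=
  unrVerticialIffHolds_of_smoothProper _ fun _ _ _ _ h => h

/-- **F-0466 / Rmk. 1.4.3 INSTANCE-PROVED at the smooth-proper one-vertex origin `Ω_sp`** (closed,
binder-free; by `auxiliaryCoveringsExistHolds_of_smoothProper`: the cuspidal and nodal clauses are vacuous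
— no edges — and `G'' := G` serves the verticial clause since `Π_v = Π`).  CAVEAT: the same row is REFUTED
at the genuine smooth-curve origins with `≥ 2` cusps and at the two-component origins
(`not_auxiliaryCoveringsExistHolds_of_smoothCurveGenuine`, `…_of_twoComponentOrigin`) and its universal
closure is refuted (`not_forall_auxiliaryCoveringsExistHolds`); instance of the typed schema only.
[cite: MochizukiCombGC2007, Rmk 1.4.3 p.12] -/
theorem auxiliaryCoveringsExistHolds_smoothProperOrigin :
    Literature.AnabelianGeometry.SemiGraphs.PSCDatum.AuxiliaryCoveringsExistHolds
      (⟨fun H => IsEmpty H.graph.N ∧ IsEmpty H.graph.C ∧ (∀ v, H.vertGp v = ⊤) ∧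
          ∃ v₀ : H.graph.V, ∀ w, w = v₀⟩ : PSCOrigin.{0}) :=
  auxiliaryCoveringsExistHolds_of_smoothProper _ fun _ _ _ _ h => h

/-! ### F-0442: Prop. 1.5 (ii) at the genuine datum `Ŝ₂` (closed instance forms) -/

/-- **F-0442 / Prop. 1.5 (ii) INSTANCE-PROVED at the genuine datum `Ŝ₂` of a smooth proper genus-2 curve,
for EVERY `α : Ŝ₂ ≃ₜ* Ŝ₂`** (the datum — written in the statement, no definition — is the one of
`smoothProperOrigin_isOfPSCType_genusTwo`: `Σ` = all primes, one vertex of genus 2, `Π_v = Π = Ŝ₂`, no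
nodes, no cusps; both `G` and `H` are taken to be it).  By abc-iut-L3-t4's
`graphicIffEdgeLikeVerticial_of_smoothProper`: every `α` is graphic, group-theoretically edge-like
(vacuously) and verticial, and the semi-graph isomorphism is unique.  The universal closure of the predicate
is refuted (`exists_not_graphicIffEdgeLikeVerticial`, `not_forall_graphicIffEdgeLikeVerticial`); instance of
the typed predicate only. [cite: MochizukiCombGC2007, Prop 1.5(ii) p.13] -/
theorem graphicIffEdgeLikeVerticial_genusTwoProper
    (α : profiniteCompletion (SurfaceGroup 2) ≃ₜ* profiniteCompletion (SurfaceGroup 2)) :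
    let G : PSCDatum (profiniteCompletion (SurfaceGroup 2)) :=
      { Sigma := {p | p.Prime}
        sigma_prime := fun _ hp => hp
        sigma_nonempty := ⟨2, Nat.prime_two⟩
        graph := { V := Unit, N := Empty, C := Empty, nodeEnds := Empty.elim, cuspEnd := Empty.elim }
        vertGp := fun _ => ⊤
        nodeGp := Empty.elim
        cuspGp := Empty.elim
        genus := fun _ => 2
        isClosed_vertGp := fun _ => by rw [Subgroup.coe_top]; exact isClosed_univ
        isClosed_nodeGp := fun e => e.elim
        isClosed_cuspGp := fun c => c.elim
        nodeGp_le := fun e => e.elim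
        cuspGp_le := fun c => c.elim
        proSigma := ⟨fun _ _ _ hp _ => hp⟩ }
    Literature.AnabelianGeometry.SemiGraphs.PSCDatum.GraphicIffEdgeLikeVerticial G G α := by
  intro G
  haveI : IsEmpty G.graph.N := inferInstanceAs (IsEmpty Empty)
  haveI : IsEmpty G.graph.C := inferInstanceAs (IsEmpty Empty)
  exact G.graphicIffEdgeLikeVerticial_of_smoothProper G (fun _ => rfl) () (fun _ => rfl) (fun _ => rfl) ()
    (fun _ => rfl) α

/-- **F-0442 / Prop. 1.5 (ii), fully closed case `α = id_{Ŝ₂}`** of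
`graphicIffEdgeLikeVerticial_genusTwoProper` (0 binders). [cite: MochizukiCombGC2007, Prop 1.5(ii) p.13] -/
theorem graphicIffEdgeLikeVerticial_genusTwoProper_refl :
    let G : PSCDatum (profiniteCompletion (SurfaceGroup 2)) :=
      { Sigma := {p | p.Prime}
        sigma_prime := fun _ hp => hp
        sigma_nonempty := ⟨2, Nat.prime_two⟩
        graph := { V := Unit, N := Empty, C := Empty, nodeEnds := Empty.elim, cuspEnd := Empty.elim }
        vertGp := fun _ => ⊤
        nodeGp := Empty.elim
        cuspGp := Empty.elim
        genus := fun _ => 2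
        isClosed_vertGp := fun _ => by rw [Subgroup.coe_top]; exact isClosed_univ
        isClosed_nodeGp := fun e => e.elim
        isClosed_cuspGp := fun c => c.elim
        nodeGp_le := fun e => e.elim
        cuspGp_le := fun c => c.elim
        proSigma := ⟨fun _ _ _ hp _ => hp⟩ }
    Literature.AnabelianGeometry.SemiGraphs.PSCDatum.GraphicIffEdgeLikeVerticial G G
      (ContinuousMulEquiv.refl (profiniteCompletion (SurfaceGroup 2))) :=
  graphicIffEdgeLikeVerticial_genusTwoProper (ContinuousMulEquiv.refl _)

/-- **F-0442 with the genuine provenance displayed**: there is a datum `G` over `Ŝ₂` — `toCompletion`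
a certified pro-`Σ` completion `S_2 → Ŝ₂` for `Σ = G.Sigma` = all primes, one vertex of genus 2 with
`Π_v = Π`, no nodes, no cusps, sturdy — such that Prop. 1.5 (ii) holds for `(G, G, α)` for every
`α : Ŝ₂ ≃ₜ* Ŝ₂`. [cite: MochizukiCombGC2007, Prop 1.5(ii) p.13] -/
theorem exists_genuine_graphicIffEdgeLikeVerticial :
    ∃ G : PSCDatum (profiniteCompletion (SurfaceGroup 2)),
      (∀ α : profiniteCompletion (SurfaceGroup 2) ≃ₜ* profiniteCompletion (SurfaceGroup 2),
        Literature.AnabelianGeometry.SemiGraphs.PSCDatum.GraphicIffEdgeLikeVerticial G G α) ∧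
      IsProSigmaCompletion G.Sigma (toCompletion (SurfaceGroup 2)) ∧ G.Sigma = {p | p.Prime} ∧
      G.graph.i = 1 ∧ G.graph.n = 0 ∧ G.graph.r = 0 ∧ (∀ v, G.vertGp v = ⊤ ∧ G.genus v = 2) ∧
      G.IsSturdy :=
  ⟨_, graphicIffEdgeLikeVerticial_genusTwoProper,
    IsProSigmaCompletion.isProSigmaCompletion_toCompletion (SurfaceGroup 2), rfl, rfl, rfl, rfl,
    fun _ => ⟨rfl, rfl⟩, fun _ => le_rfl⟩

end PSCDatum

end Literature.AnabelianGeometry.SemiGraphs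

end
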